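import Summits.Ventures.HSemireg.WedgeSurfacePowers

/-!
# Venture HSemireg — the PER-`q` (Dolbeault-block) ranks of the `n`-fold SURFACE BOX `θ ↦ θ ∧ (f₀ ∧ ⋯ ∧ f_{n−1})`, 1/3:
# the local model on ONE surface block (targets of a local source, the six canonical local sources, local classification)
# and its transport into block `i` of `Fin (4n)`; canonical sources; the Dolbeault index `q`

HONEST FRAMING. Part of the Lean index of the computation cell `pub-hsemireg` (seat p10 gen 3, Sunday typer «UNIFORM-IN-n»).
Finite-dimensional EXTERIOR ALGEBRA over a field ONLY: no variety, no cohomology theory, no sheaf, no Ext group, no semiregularity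
map is constructed here; nothing here says that HC / HC_CM / HC_AV holds; no Literature fact is declared or used.  Custodian
versions: STRUCTURE.md v1.0-SIGNED 9b196a05977dd067 (§1.1 C10 / C13), theory/FORMULA-N.md PART A §4.1″ (th-6), PART B §A.3 / §E (th-7).

THE QUESTION (th-6, FORMULA-N PART A §4.1″, the caveat of record): for the SURFACE POWER `F_n = ⊠ⁿ I_{p_i}` with `n ≥ 3` factors
the naive per-`q` count `[t^k u^q] Q_2(t,u)ⁿ` OVERCOUNTS the block ranks («each T⁰ is ONE vector 1 − pt with two q-components»);
p10 gen 2 typed the corrected enumerator `spCount n k q` (`FormulaNSurfacePowerPerQ.lean`) and checked it against every measured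
row, leaving the RANK statement behind it «NOT typed» (HOME/p10/SURFACE-POWER-PERQ-p10.md §2).  Files 1/3–3/3 prove it, for
every field, every `n`, `k`, `q`: `rank(q-block of θ ↦ θ ∧ F_n ∣ ⋀^k K^{4n}) = spCount n k q`
(`WedgeSurfacePowersPerQRank.finrank_range_blockProj_wedge_surfaceBox`).

THE MODEL is th-7's, typed in `WedgeSurfacePowers.lean` (p10 gen 2): generators `Fin (4n)` in `n` blocks `D i = {4i, …, 4i+3}`,
`X_i = {4i, 4i+1}`, `Y_i = {4i+2, 4i+3}`, `f_i = a·E_{X_i} + c·E_{Y_i}` (the surface point pair embedded along `blockEmb n i :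
Fin 4 ↪o Fin (4n)`), `F_n = surfaceBox = f₀ ∧ ⋯ ∧ f_{n−1}`.  DICTIONARY (quoted from th-6 §4.1″ / th-7 PART B §A.3 and
`WedgeBoxPerQ.lean`, NOT asserted): `X`-letters ↔ `H⁰(T)`-directions, `Y`-letters ↔ `H¹(𝒪)`-directions, so the Dolbeault index `q`
of a target monomial `E_T` (the `q` of the block `⊕ H^{q+m}(Ω^q)` it models) is the number of `X`-generators MISSING from `T`
(`qdeg`, §3; additive over the blocks, `qdeg_eq_sum`).
THIS FILE: §1 the LOCAL MODEL on the four letters of one block, in the generic wedge model `Wedge.B K (Fin 4)`: the local image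
`E_t ∧ (a E_X + c E_Y) = a·u(t,X)·E_{t⊔X} + c·u(t,Y)·E_{t⊔Y}` (`B_mul_surf`), its support = the LOCAL TARGETS `ltg t`
(`coord_B_mul_surf_ne_zero_iff`, `a, c ≠ 0`); the six CANONICAL local sources `opt : Fin 6 → Finset (Fin 4)` = `∅, {0}, {1}, {2},
{3}, {0,1}` (one per source class: `E_Y ∧ f ∝ E_X ∧ f`, and a source meeting both `X` and `Y` is dead — `local_class`), their
default targets, local `q` (`lq`, `lqf`, `lq_of_mem_ltg`: a target of a canonical source has `q` = fixed part, `+2` exactly for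
the target `Y` of the empty source) and «a local target determines the class» (`opt_eq_of_mem_ltg`) — all finite checks on
`Finset (Fin 4)` by `decide`; §2 TRANSPORT into block `i`: lifts / pull-backs of letter sets, `coord_emb` (coordinates along
th-7's block embedding `Wedge.Kunneth.emb`), the local image `limg s i = E_{s ∩ D_i} ∧ f_i` of a source and its block
coordinates (`coord_limg_ne_zero_iff`); §3 the canonical source `src f` of option data `f : Fin n → Fin 6`, `|s| = Σ_i |pb_i s|`,
and `qdeg` with `mem_XX` (the `X`-generators are the values `≡ 0, 1 mod 4`) and `qdeg_eq_sum`.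
Namespace `Summit.Ventures.HSemireg.Wedge.SurfacePowers` (p10 gen 2's), new names only; nothing of th-7 / th-6 / p3 restated.
-/

open Module Set Set.powersetCard

namespace Summit.Ventures.HSemireg.Wedge.SurfacePowers

open Summit.Ventures.HSemireg.Wedge Summit.Ventures.HSemireg.Wedge.Kunneth

variable (K : Type*) [Field K]

/-! ## §1. The local model on four generators -/

/-- the `X` letters `{0, 1}` of one surface block (dictionary: `H⁰(T)`-directions). -/
def X4 : Finset (Fin (2 + 2)) := WedgePair.Xset 2

/-- the `Y` letters `{2, 3}` of one surface block (dictionary: `H¹(𝒪)`-directions). -/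
def Y4 : Finset (Fin (2 + 2)) := WedgePair.Yset 2

/-- `X = {0, 1}`. -/
lemma X4_eq : X4 = {0, 1} := by decide

/-- `Y = {2, 3}`. -/
lemma Y4_eq : Y4 = {2, 3} := by decide

/-- the surface factor is `a·E_X + c·E_Y` in the generic wedge model on `Fin 4`. -/
lemma surf_eq (a c : K) : surf K a c = a • B K (Fin (2 + 2)) X4 + c • B K (Fin (2 + 2)) Y4 := rfl

/-- `E_t ∧ (a E_X + c E_Y) = a·u(t,X)·E_{t ∪ X} + c·u(t,Y)·E_{t ∪ Y}`. -/
lemma B_mul_surf (a c : K) (t : Finset (Fin (2 + 2))) :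
    B K (Fin (2 + 2)) t * surf K a c =
      (a * u K t X4) • B K (Fin (2 + 2)) (t ∪ X4) + (c * u K t Y4) • B K (Fin (2 + 2)) (t ∪ Y4) := by
  rw [surf_eq, mul_add, mul_smul_comm, mul_smul_comm, B_mul_B, B_mul_B, smul_smul, smul_smul]

/-- coordinates of a monomial. -/
lemma coord_B {I : Type*} [LinearOrder I] [Fintype I] (T s : Finset I) :
    (B K I).coord T (B K I s) = if s = T then 1 else 0 := by
  rw [Basis.coord_apply, Basis.repr_self, Finsupp.single_apply]

/-- the local coordinates of `E_t ∧ (a E_X + c E_Y)`. -/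
lemma coord_B_mul_surf (a c : K) (t T : Finset (Fin (2 + 2))) :
    (B K (Fin (2 + 2))).coord T (B K (Fin (2 + 2)) t * surf K a c) =
      (if t ∪ X4 = T then a * u K t X4 else 0) + (if t ∪ Y4 = T then c * u K t Y4 else 0) := by
  rw [B_mul_surf, map_add, map_smul, map_smul, coord_B, coord_B, smul_eq_mul, smul_eq_mul, mul_ite, mul_ite,
    mul_one, mul_zero, mul_one, mul_zero]

/-- the LOCAL TARGETS of a local source `t`: the monomials `E_T` that CAN occur in `E_t ∧ (a E_X + c E_Y)` — `T = t ⊔ X` with `t`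
disjoint from `X` (the global component) or `T = t ⊔ Y` with `t` disjoint from `Y` (the local component). -/
def ltg (t : Finset (Fin (2 + 2))) : Finset (Finset (Fin (2 + 2))) :=
  Finset.univ.filter fun T => (Disjoint t X4 ∧ t ∪ X4 = T) ∨ (Disjoint t Y4 ∧ t ∪ Y4 = T)

/-- membership in the local targets. -/
lemma mem_ltg {t T : Finset (Fin (2 + 2))} :
    T ∈ ltg t ↔ (Disjoint t X4 ∧ t ∪ X4 = T) ∨ (Disjoint t Y4 ∧ t ∪ Y4 = T) := by
  simp [ltg]

/-- the two components never coincide. -/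
lemma not_hit_both : ∀ t T : Finset (Fin (2 + 2)), ¬ ((Disjoint t X4 ∧ t ∪ X4 = T) ∧ (Disjoint t Y4 ∧ t ∪ Y4 = T)) := by
  decide

variable {K}

/-- **local support**: for `a, c ≠ 0`, `E_T` occurs in `E_t ∧ (a E_X + c E_Y)` iff `T` is a local target of `t`. -/
theorem coord_B_mul_surf_ne_zero_iff {a c : K} (ha : a ≠ 0) (hc : c ≠ 0) (t T : Finset (Fin (2 + 2))) :
    (B K (Fin (2 + 2))).coord T (B K (Fin (2 + 2)) t * surf K a c) ≠ 0 ↔ T ∈ ltg t := by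
  rw [coord_B_mul_surf, mem_ltg]
  have h1 : (if t ∪ X4 = T then a * u K t X4 else 0) ≠ 0 ↔ Disjoint t X4 ∧ t ∪ X4 = T := by
    split_ifs with h
    · rw [mul_ne_zero_iff, u_ne_zero_iff]; tauto
    · tauto
  have h2 : (if t ∪ Y4 = T then c * u K t Y4 else 0) ≠ 0 ↔ Disjoint t Y4 ∧ t ∪ Y4 = T := by
    split_ifs with h
    · rw [mul_ne_zero_iff, u_ne_zero_iff]; tauto
    · tauto
  have h12 := not_hit_both t T
  constructor
  · intro h
    by_contra hn
    rw [not_or, ← h1, ← h2, not_ne_iff, not_ne_iff] at hn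
    rw [hn.1, hn.2, add_zero] at h
    exact h rfl
  · rintro (hX | hY)
    · have e2 : (if t ∪ Y4 = T then c * u K t Y4 else 0) = 0 := by
        by_contra hne; exact h12 ⟨hX, h2.mp hne⟩
      rw [e2, add_zero]; exact h1.mpr hX
    · have e1 : (if t ∪ X4 = T then a * u K t X4 else 0) = 0 := by
        by_contra hne; exact h12 ⟨h1.mp hne, hY⟩
      rw [e1, zero_add]; exact h2.mpr hY

/-! ### The six canonical local sources -/

/-- the six CANONICAL local sources (one per source class of a surface block): `∅` (degree 0), the four letters (degree 1:
`{0}, {1} ⊆ X` of `q`-type 1, `{2}, {3} ⊆ Y` of `q`-type 0) and `X = {0,1}` (degree 2, top collapse; the class of `Y` too). -/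
def opt : Fin 6 → Finset (Fin (2 + 2)) := ![∅, {0}, {1}, {2}, {3}, {0, 1}]

/-- `opt` is injective. -/
lemma opt_injective : Function.Injective opt := by decide

/-- the default local target of a canonical source: `X` for `∅`, `t ⊔ Y` for `t ⊆ X` non-empty, `t ⊔ X` for `t ⊆ Y`. -/
def ltgt (o : Fin 6) : Finset (Fin (2 + 2)) := ![X4, {0} ∪ Y4, {1} ∪ Y4, {2} ∪ X4, {3} ∪ X4, X4 ∪ Y4] o

/-- the local `q` of a target monomial: the number of `X` letters it misses (WedgeBoxPerQ's Dolbeault index, one block). -/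
def lq (T : Finset (Fin (2 + 2))) : ℕ := (X4 \ T).card

/-- the fixed `q`-part of a canonical source: `1` for a single `X` letter, else `0`. -/
def lqf (o : Fin 6) : ℕ := ![0, 1, 1, 0, 0, 0] o

/-- the empty-block indicator of a canonical source. -/
def lz (o : Fin 6) : ℕ := ![1, 0, 0, 0, 0, 0] o

/-- the default target is a target, of local `q` equal to the fixed part. -/
lemma ltgt_mem_ltg : ∀ o : Fin 6, ltgt o ∈ ltg (opt o) ∧ lq (ltgt o) = lqf o := by decide

/-- the empty source also reaches `Y`, of local `q = 2`. -/
lemma Y4_mem_ltg_empty : Y4 ∈ ltg (opt 0) ∧ lq Y4 = 2 ∧ opt 0 = ∅ ∧ lqf 0 = 0 := by decide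

/-- every local target of a canonical source has local `q` = fixed part, plus `2` exactly for the target `Y` of the empty source. -/
lemma lq_of_mem_ltg : ∀ o : Fin 6, ∀ T ∈ ltg (opt o), lq T = lqf o + (if o = 0 ∧ T = Y4 then 2 else 0) := by decide

/-- a local target determines the canonical source (distinct classes have disjoint supports). -/
lemma opt_eq_of_mem_ltg : ∀ o o' : Fin 6, ∀ T ∈ ltg (opt o), T ∈ ltg (opt o') → o = o' := by decide

/-- `lz` is the indicator of the empty source and the degree is the cardinality. -/
lemma lz_eq : ∀ o : Fin 6, lz o = (if opt o = ∅ then 1 else 0) ∧ (opt o = ∅ ↔ o = 0) := by decide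

/-- trichotomy of local sources: canonical, the block `Y` (class of `X`), or DEAD (meets both `X` and `Y`). -/
lemma local_trichotomy : ∀ t : Finset (Fin (2 + 2)), (∃ o, opt o = t) ∨ t = Y4 ∨ (¬ Disjoint t X4 ∧ ¬ Disjoint t Y4) := by
  decide

/-- **local classification**: every local image `E_t ∧ (a E_X + c E_Y)` is `0` or a multiple of the image of a canonical source of
the same degree (for `t = Y`: `E_Y ∧ f = a·u·E_{X ⊔ Y}` is a multiple of `E_X ∧ f = c·u′·E_{X ⊔ Y}`, `c ≠ 0`). -/
theorem local_class {a c : K} (hc : c ≠ 0) (t : Finset (Fin (2 + 2))) :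
    B K (Fin (2 + 2)) t * surf K a c = 0 ∨
      ∃ o : Fin 6, (opt o).card = t.card ∧ ∃ μ : K, B K (Fin (2 + 2)) t * surf K a c = μ • (B K (Fin (2 + 2)) (opt o) * surf K a c) := by
  rcases local_trichotomy t with ⟨o, rfl⟩ | rfl | ⟨hX, hY⟩
  · exact Or.inr ⟨o, rfl, 1, by rw [one_smul]⟩
  · refine Or.inr ⟨5, by decide, a * u K Y4 X4 * (c * u K X4 Y4)⁻¹, ?_⟩
    have hXY : Disjoint X4 Y4 := by decide
    have h5 : opt 5 = X4 := by decide
    rw [h5, B_mul_surf, B_mul_surf, u_eq_zero K (t := Y4) (by decide), u_eq_zero K (s := X4) (t := X4) (by decide),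
      mul_zero, zero_smul, add_zero, mul_zero, zero_smul, zero_add, smul_smul, Finset.union_comm Y4 X4,
      inv_mul_cancel_right₀ (mul_ne_zero hc ((u_ne_zero_iff K).mpr hXY))]
  · left
    rw [B_mul_surf, u_eq_zero K hX, u_eq_zero K hY, mul_zero, mul_zero, zero_smul, zero_smul, add_zero]


/-! ## §2. Transport into block `i` of `Fin (4n)` -/

variable (n : ℕ)

/-- the lift of a set of local letters into block `i`: `t ↦ {4i + j : j ∈ t}`. -/
def lift (i : Fin n) (t : Finset (Fin (2 + 2))) : Finset (Fin (4 * n)) := t.map (blockEmb n i).toEmbedding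

/-- the pull-back of a set of generators to the local letters of block `i`. -/
def pb (i : Fin n) (T : Finset (Fin (4 * n))) : Finset (Fin (2 + 2)) := Finset.univ.filter fun j => blockEmb n i j ∈ T

variable {n}

/-- membership in a lift. -/
lemma mem_lift {i : Fin n} {t : Finset (Fin (2 + 2))} {x : Fin (4 * n)} : x ∈ lift n i t ↔ ∃ j ∈ t, blockEmb n i j = x := by
  simp [lift]

/-- membership in a pull-back. -/
lemma mem_pb {i : Fin n} {T : Finset (Fin (4 * n))} {j : Fin (2 + 2)} : j ∈ pb n i T ↔ blockEmb n i j ∈ T := by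
  simp [pb]

/-- the block of a lifted letter. -/
lemma blockEmb_mem_D_iff {i i' : Fin n} {j : Fin (2 + 2)} : blockEmb n i j ∈ D n i' ↔ i = i' := by
  rw [mem_D, blockEmb_val]
  have := j.2
  constructor
  · intro h; apply Fin.ext; omega
  · rintro rfl; omega

/-- distinct blocks are disjoint. -/
lemma disjoint_D {i i' : Fin n} (h : i ≠ i') : Disjoint (D n i) (D n i') := by
  rw [Finset.disjoint_left]
  intro x h1 h2
  rw [mem_D] at h1 h2
  apply h
  apply Fin.ext
  omega

/-- a lift lies in its block. -/
lemma lift_subset_D (i : Fin n) (t : Finset (Fin (2 + 2))) : lift n i t ⊆ D n i := by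
  intro x hx
  obtain ⟨j, -, rfl⟩ := mem_lift.mp hx
  exact blockEmb_mem_D_iff.mpr rfl

/-- lifting the pull-back recovers the part of `T` in block `i`. -/
lemma lift_pb (i : Fin n) (T : Finset (Fin (4 * n))) : lift n i (pb n i T) = T ∩ D n i := by
  ext x
  rw [mem_lift, Finset.mem_inter]
  constructor
  · rintro ⟨j, hj, rfl⟩
    exact ⟨mem_pb.mp hj, blockEmb_mem_D_iff.mpr rfl⟩
  · rintro ⟨hT, hD⟩
    rw [D, Finset.mem_map] at hD
    obtain ⟨j, -, rfl⟩ := hD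
    exact ⟨j, mem_pb.mpr hT, rfl⟩

/-- pulling back a lift recovers the local letters. -/
lemma pb_lift (i : Fin n) (t : Finset (Fin (2 + 2))) : pb n i (lift n i t) = t := by
  ext j
  rw [mem_pb, mem_lift]
  constructor
  · rintro ⟨j', hj', e⟩
    rwa [← (blockEmb n i).injective e]
  · intro hj
    exact ⟨j, hj, rfl⟩

/-- cardinality of a lift. -/
lemma card_lift (i : Fin n) (t : Finset (Fin (2 + 2))) : (lift n i t).card = t.card := Finset.card_map _

variable (K)

/-- **coordinates transport along the block embedding**: the `lift T₀`-coordinate of an embedded element is its local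
`T₀`-coordinate. -/
theorem coord_emb (i : Fin n) (T₀ : Finset (Fin (2 + 2))) (v : HT K (Fin (2 + 2))) :
    (B K (Fin (4 * n))).coord (lift n i T₀) (emb K (blockEmb n i) v) = (B K (Fin (2 + 2))).coord T₀ v := by
  have key : (B K (Fin (4 * n))).coord (lift n i T₀) ∘ₗ (emb K (blockEmb n i)).toLinearMap = (B K (Fin (2 + 2))).coord T₀ := by
    apply (B K (Fin (2 + 2))).ext
    intro t
    rw [LinearMap.comp_apply, AlgHom.toLinearMap_apply, emb_B, coord_B, coord_B]
    simp only [lift, (Finset.map_injective (blockEmb n i).toEmbedding).eq_iff]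
  rw [← key, LinearMap.comp_apply, AlgHom.toLinearMap_apply]

/-! ### The local image of a source on block `i` -/

/-- the LOCAL IMAGE of a source monomial `E_s` on block `i`: `E_{s ∩ D_i} ∧ f_i`. -/
noncomputable def limg (a c : K) (s : Finset (Fin (4 * n))) (i : Fin n) : HT K (Fin (4 * n)) :=
  B K (Fin (4 * n)) (s ∩ D n i) * fac K a c i

/-- the local image is the embedded local product `E_{pb s} ∧ (a E_X + c E_Y)`. -/
lemma limg_eq_emb (a c : K) (s : Finset (Fin (4 * n))) (i : Fin n) :
    limg K a c s i = emb K (blockEmb n i) (B K (Fin (2 + 2)) (pb n i s) * surf K a c) := by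
  rw [limg, map_mul, emb_B, ← lift_pb]
  rfl

/-- the local image lies in the block algebra. -/
lemma limg_mem_Alg (a c : K) (s : Finset (Fin (4 * n))) (i : Fin n) : limg K a c s i ∈ Alg K (Fin (4 * n)) (D n i) :=
  mul_mem_Alg K (B_mem_Alg K Finset.inter_subset_right) (Hom_le_Alg K _ _ (fac_mem_Hom K a c i))

/-- **block coordinates of the local image are local coordinates**: the `T ∩ D_i`-coordinate of `E_{s ∩ D_i} ∧ f_i` is the local
coordinate of `E_{pb s} ∧ (a E_X + c E_Y)` at `pb T`. -/
theorem coord_limg (a c : K) (s T : Finset (Fin (4 * n))) (i : Fin n) :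
    (B K (Fin (4 * n))).coord (T ∩ D n i) (limg K a c s i) =
      (B K (Fin (2 + 2))).coord (pb n i T) (B K (Fin (2 + 2)) (pb n i s) * surf K a c) := by
  rw [limg_eq_emb, ← lift_pb, coord_emb]

/-- so it is non-zero iff `pb T` is a local target of `pb s` (`a, c ≠ 0`). -/
theorem coord_limg_ne_zero_iff {a c : K} (ha : a ≠ 0) (hc : c ≠ 0) (s T : Finset (Fin (4 * n))) (i : Fin n) :
    (B K (Fin (4 * n))).coord (T ∩ D n i) (limg K a c s i) ≠ 0 ↔ pb n i T ∈ ltg (pb n i s) := by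
  rw [coord_limg, coord_B_mul_surf_ne_zero_iff ha hc]


/-! ## §3. Canonical sources from option data, and the Dolbeault index `q` on `Fin (4n)` -/

/-- the CANONICAL SOURCE of option data `f` (one canonical local source per block): `⋃_i lift_i (opt (f i))`. -/
def src (f : Fin n → Fin 6) : Finset (Fin (4 * n)) := Finset.univ.biUnion fun i => lift n i (opt (f i))

/-- block `i` of the canonical source is the chosen local source. -/
lemma pb_src (f : Fin n → Fin 6) (i : Fin n) : pb n i (src f) = opt (f i) := by
  ext j
  rw [mem_pb, src, Finset.mem_biUnion]
  constructor
  · rintro ⟨i', -, h⟩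
    obtain rfl : i = i' := blockEmb_mem_D_iff.mp (lift_subset_D i' _ h)
    obtain ⟨j', hj', e⟩ := mem_lift.mp h
    rwa [← (blockEmb n i).injective e]
  · intro hj
    exact ⟨i, Finset.mem_univ _, mem_lift.mpr ⟨j, hj, rfl⟩⟩

/-- the degree of the canonical source is the sum of the local degrees. -/
lemma card_src (f : Fin n → Fin 6) : (src f).card = ∑ i, (opt (f i)).card := by
  rw [src, Finset.card_biUnion]
  · exact Finset.sum_congr rfl fun i _ => card_lift i _
  · intro i _ i' _ h
    exact disjoint_of_subsets (disjoint_D h) (lift_subset_D i _) (lift_subset_D i' _)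

/-- every generator lies in exactly one block: the pull-backs of `s` partition it, so `|s| = Σ_i |pb_i s|`. -/
lemma card_eq_sum_card_pb (s : Finset (Fin (4 * n))) : s.card = ∑ i, (pb n i s).card := by
  have hs : s = Finset.univ.biUnion fun i => lift n i (pb n i s) := by
    ext x
    rw [Finset.mem_biUnion]
    constructor
    · intro hx
      have h4 : (x : ℕ) / 4 < n := by have := x.2; omega
      refine ⟨⟨x / 4, h4⟩, Finset.mem_univ _, ?_⟩
      rw [lift_pb, Finset.mem_inter, mem_D]
      exact ⟨hx, by simp only; omega⟩
    · rintro ⟨i, -, h⟩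
      rw [lift_pb, Finset.mem_inter] at h
      exact h.1
  conv_lhs => rw [hs]
  rw [Finset.card_biUnion]
  · exact Finset.sum_congr rfl fun i _ => card_lift i _
  · intro i _ i' _ h
    exact disjoint_of_subsets (disjoint_D h) (lift_subset_D i _) (lift_subset_D i' _)

variable (n)

/-- ALL `X`-generators of `Fin (4n)`: the lifts of `X = {0,1}` (values `≡ 0, 1 mod 4`). -/
def XX : Finset (Fin (4 * n)) := Finset.univ.biUnion fun i => lift n i X4

/-- the DOLBEAULT INDEX `q` of a target monomial `E_T`: the number of `X`-generators missing from `T` (the WedgeBoxPerQ dictionary,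
quoted: `X`-letters model `H⁰(T)`-directions, so a target in `H^{q+m}(Ω^q)` misses exactly `q` of them; additive over the blocks). -/
def qdeg (T : Finset (Fin (4 * n))) : ℕ := (XX n \ T).card

variable {n}

/-- membership in `XX` by value: `x mod 4 ∈ {0, 1}`. -/
lemma mem_XX {x : Fin (4 * n)} : x ∈ XX n ↔ (x : ℕ) % 4 < 2 := by
  rw [XX, Finset.mem_biUnion]
  constructor
  · rintro ⟨i, -, h⟩
    obtain ⟨j, hj, rfl⟩ := mem_lift.mp h
    rw [X4, WedgePair.mem_Xset] at hj
    rw [blockEmb_val]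
    omega
  · intro hx
    have h4 : (x : ℕ) / 4 < n := by have := x.2; omega
    refine ⟨⟨x / 4, h4⟩, Finset.mem_univ _, mem_lift.mpr ⟨⟨x % 4, by omega⟩, ?_, Fin.ext ?_⟩⟩
    · rw [X4, WedgePair.mem_Xset]; exact hx
    · rw [blockEmb_val]; simp only; omega

/-- **`q` is additive over the blocks**: `qdeg T = Σ_i lq (pb_i T)`. -/
theorem qdeg_eq_sum (T : Finset (Fin (4 * n))) : qdeg n T = ∑ i, lq (pb n i T) := by
  have h1 : XX n \ T = Finset.univ.biUnion fun i => lift n i (X4 \ pb n i T) := by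
    ext x
    rw [Finset.mem_sdiff, XX, Finset.mem_biUnion, Finset.mem_biUnion]
    constructor
    · rintro ⟨⟨i, -, h⟩, hT⟩
      obtain ⟨j, hj, rfl⟩ := mem_lift.mp h
      exact ⟨i, Finset.mem_univ _, mem_lift.mpr ⟨j, Finset.mem_sdiff.mpr ⟨hj, fun h' => hT (mem_pb.mp h')⟩, rfl⟩⟩
    · rintro ⟨i, -, h⟩
      obtain ⟨j, hj, rfl⟩ := mem_lift.mp h
      rw [Finset.mem_sdiff] at hj
      exact ⟨⟨i, Finset.mem_univ _, mem_lift.mpr ⟨j, hj.1, rfl⟩⟩, fun h' => hj.2 (mem_pb.mpr h')⟩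
  rw [qdeg, h1, Finset.card_biUnion]
  · exact Finset.sum_congr rfl fun i _ => card_lift i _
  · intro i _ i' _ h
    exact disjoint_of_subsets (disjoint_D h) (lift_subset_D i _) (lift_subset_D i' _)

end Summit.Ventures.HSemireg.Wedge.SurfacePowers
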